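import Literature.NumberTheory.Automorphic.QuadraticHeckeCharacterArchComponent
import Literature.NumberTheory.QuadraticForms.HilbertSymbolArchimedean
import HarnessLib

/-!
# The quadratic Hecke character at the infinite places: trivial at complex places and at real places where
# `θ > 0`, the sign character at real places where `θ < 0`

Topic `NumberTheory/Automorphic`; namespace `Literature.NumberTheory.Automorphic`. Everything here is proved; a
corollary file of `QuadraticHeckeCharacterArchComponent.lean` (`ω(⟨c⟩_w) = (c, θ)_w`) and
`QuadraticForms/HilbertSymbolArchimedean.lean` (the Hilbert symbol of `ℝ` and `ℂ`).

For a number field `K`, a non-square `θ ∈ 𝓞 K`, `ω = quadraticHeckeChar K θ` and an infinite place `w` with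
`⟨c⟩_w = infiniteIdeleSingle w c`:

* `quadraticHeckeChar_infiniteIdeleSingle_of_isComplex` — `w` complex: `ω(⟨c⟩_w) = 1` (`K_w ≅ ℂ` is
  algebraically closed);
* `quadraticHeckeChar_infiniteIdeleSingle_eq_one_iff_of_isReal` — `w` real, `K_w ≅ ℝ` (Mathlib
  `Completion.ringEquivRealOfIsReal`): `ω(⟨c⟩_w) = 1 ↔ c > 0 ∨ σ_w(θ) > 0`;
* `quadraticHeckeChar_infiniteIdeleSingle_of_pos` — `w` real with `σ_w(θ) > 0` (`w` splits in `K(√θ)`):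
  `ω(⟨c⟩_w) = 1`;
* `quadraticHeckeChar_infiniteIdeleSingle_of_neg` — `w` real with `σ_w(θ) < 0` (`w` ramifies in `K(√θ)`,
  e.g. EVERY real place of `L⁺` for a CM field `L = L⁺(√θ)`): **`ω(⟨c⟩_w) = sgn(c)`**, i.e. `1` if `c > 0` and
  `-1` if `c < 0` — the archimedean type "`sgn` at every real place" of `ε_{L/L⁺}` used in PerL v5 §3.2
  (tex ll. 305–307, parity condition `m_b ≡ m (mod 2)`).

Provenance: tree-vocabulary form of the `pub-hodgecm` package theorems `NumberField.quadraticCharacter_single_of_isReal`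
(`HodgeCM/Literature/QuadraticCharacter.lean`, gen 6) and the archimedean-type clause of
`QuadraticCharacterCM.lean` (`quadraticCharacterCM_infUnitsToClass_zpow`), over the tree's `quadraticHeckeChar`.

## References

* O. T. O'Meara, *Introduction to Quadratic Forms*, Grundlehren 117 (1963), §63B (the symbol over `ℝ` and `ℂ`),
  §71D proof of Thm. 71:19. [Omeara1963]
-/

noncomputable section

open scoped NumberField
open NumberField IsDedekindDomain NumberField.InfinitePlace

namespace Literature.NumberTheory.Automorphic

open QuadraticForms GaloisRepresentations

variable {K : Type} [Field K] [NumberField K]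

omit [NumberField K] in
/-- At an infinite place `w`, with `e : K_w ≃+* F'` (`F' = ℝ` or `ℂ`): `(c, θ)_w = (e c, e θ)_{F'}`. [folklore] -/
private theorem hilbertSymbol_completion_eq_map {F' : Type*} [Field F'] {w : InfinitePlace K}
    (e : w.Completion ≃+* F') (c : (w.Completion)ˣ) (a : K) :
    hilbertSymbol w.Completion (c : w.Completion) (algebraMap K _ a) = hilbertSymbol F' (e c) (e (algebraMap K _ a)) :=
  (hilbertSymbol_map_ringEquiv e _ _).symm

/-- **Complex places: `ω_w = 1`.** For `w` complex and every `c ∈ K_wˣ`, `ω(⟨c⟩_w) = 1` (`(c, θ)_w = 1` as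
`K_w ≅ ℂ` is algebraically closed). [cite: Omeara1963, §63B] -/
theorem quadraticHeckeChar_infiniteIdeleSingle_of_isComplex {θ : 𝓞 K} (hθ : ¬ IsSquare (θ : K))
    {w : InfinitePlace K} (hw : w.IsComplex) (c : (w.Completion)ˣ) :
    quadraticHeckeChar K θ hθ (infiniteIdeleSingle w c) = 1 := by
  haveI : CharZero w.Completion := charZero_of_injective_algebraMap (algebraMap K w.Completion).injective
  have hθ0 : (θ : K) ≠ 0 := by exact_mod_cast RingOfIntegers.ne_zero_of_not_isSquare K hθ
  have hθw : algebraMap K w.Completion (θ : K) ≠ 0 := (_root_.map_ne_zero _).2 hθ0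
  rw [quadraticHeckeChar_infiniteIdeleSingle_eq_one_iff_mem hθ w c,
    ← hilbertSymbol_eq_one_iff_mem_quadraticNormSubgroup hθw c,
    hilbertSymbol_completion_eq_map (Completion.ringEquivComplexOfIsComplex hw) c (θ : K)]
  exact hilbertSymbol_eq_one_of_isAlgClosed (Or.inl ((_root_.map_ne_zero _).2 c.ne_zero))

/-- **Real places: `ω(⟨c⟩_w) = 1 ↔ c > 0 ∨ σ_w(θ) > 0`** (`K_w ≅ ℝ` by `Completion.ringEquivRealOfIsReal`, under
which `θ ↦ σ_w(θ)`; the Hilbert symbol of `ℝ`). [cite: Omeara1963, §63B] -/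
theorem quadraticHeckeChar_infiniteIdeleSingle_eq_one_iff_of_isReal {θ : 𝓞 K} (hθ : ¬ IsSquare (θ : K))
    {w : InfinitePlace K} (hw : w.IsReal) (c : (w.Completion)ˣ) :
    quadraticHeckeChar K θ hθ (infiniteIdeleSingle w c) = 1 ↔
      0 < Completion.ringEquivRealOfIsReal hw (c : w.Completion) ∨ 0 < embedding_of_isReal hw (θ : K) := by
  haveI : CharZero w.Completion := charZero_of_injective_algebraMap (algebraMap K w.Completion).injective
  have hθ0 : (θ : K) ≠ 0 := by exact_mod_cast RingOfIntegers.ne_zero_of_not_isSquare K hθ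
  have hθw : algebraMap K w.Completion (θ : K) ≠ 0 := (_root_.map_ne_zero _).2 hθ0
  rw [quadraticHeckeChar_infiniteIdeleSingle_eq_one_iff_mem hθ w c,
    ← hilbertSymbol_eq_one_iff_mem_quadraticNormSubgroup hθw c,
    hilbertSymbol_completion_eq_map (Completion.ringEquivRealOfIsReal hw) c (θ : K),
    ringEquivRealOfIsReal_algebraMap hw, Real.hilbertSymbol_eq_one_iff]

/-- **Real places where `θ > 0`: `ω_w = 1`** (`w` splits in `K(√θ)`). [cite: Omeara1963, §63B] -/
theorem quadraticHeckeChar_infiniteIdeleSingle_of_pos {θ : 𝓞 K} (hθ : ¬ IsSquare (θ : K))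
    {w : InfinitePlace K} (hw : w.IsReal) (hpos : 0 < embedding_of_isReal hw (θ : K)) (c : (w.Completion)ˣ) :
    quadraticHeckeChar K θ hθ (infiniteIdeleSingle w c) = 1 :=
  (quadraticHeckeChar_infiniteIdeleSingle_eq_one_iff_of_isReal hθ hw c).2 (Or.inr hpos)

/-- **Real places where `θ < 0`: `ω_w = sgn`** (`w` ramifies in `K(√θ)`; every real place of `L⁺` for a CM field
`L = L⁺(√θ)`): `ω(⟨c⟩_w) = 1 ↔ c > 0`. [cite: Omeara1963, §63B and §71D proof of Thm. 71:19] -/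
theorem quadraticHeckeChar_infiniteIdeleSingle_eq_one_iff_of_neg {θ : 𝓞 K} (hθ : ¬ IsSquare (θ : K))
    {w : InfinitePlace K} (hw : w.IsReal) (hneg : embedding_of_isReal hw (θ : K) < 0) (c : (w.Completion)ˣ) :
    quadraticHeckeChar K θ hθ (infiniteIdeleSingle w c) = 1 ↔
      0 < Completion.ringEquivRealOfIsReal hw (c : w.Completion) := by
  rw [quadraticHeckeChar_infiniteIdeleSingle_eq_one_iff_of_isReal hθ hw c]
  exact ⟨fun h => h.resolve_right (not_lt.2 hneg.le), Or.inl⟩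

/-- **Real places where `θ < 0`: the value `ω(⟨c⟩_w) = sgn(c) ∈ {±1}`.** [cite: Omeara1963, §71D proof of Thm. 71:19] -/
theorem quadraticHeckeChar_infiniteIdeleSingle_of_neg {θ : 𝓞 K} (hθ : ¬ IsSquare (θ : K))
    {w : InfinitePlace K} (hw : w.IsReal) (hneg : embedding_of_isReal hw (θ : K) < 0) (c : (w.Completion)ˣ) :
    ((quadraticHeckeChar K θ hθ (infiniteIdeleSingle w c) : ℂˣ) : ℂ) =
      if 0 < Completion.ringEquivRealOfIsReal hw (c : w.Completion) then 1 else -1 := by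
  have hθ0 : (θ : K) ≠ 0 := by exact_mod_cast RingOfIntegers.ne_zero_of_not_isSquare K hθ
  split_ifs with hc
  · rw [(quadraticHeckeChar_infiniteIdeleSingle_eq_one_iff_of_neg hθ hw hneg c).2 hc, Units.val_one]
  · have hne : quadraticHeckeChar K θ hθ (infiniteIdeleSingle w c) ≠ 1 := fun h =>
      hc ((quadraticHeckeChar_infiniteIdeleSingle_eq_one_iff_of_neg hθ hw hneg c).1 h)
    have hmem : infiniteIdeleSingle w c ∉ principalIdeles K ⊔ normIdeles K (θ : K) := fun h =>
      hne (quadraticHeckeChar_apply_of_mem hθ h)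
    rw [quadraticHeckeChar_apply_of_not_mem hθ hmem, Units.val_neg, Units.val_one]

end Literature.NumberTheory.Automorphic

end
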